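import Summits.Langlands.Langlands.Theorems.SoloInformedGLOneUnconditional
import Literature.NumberTheory.GaloisRepresentations.HeckeCharacterLAdicDeRham
import HarnessLib

/-!
# SoloInformedGLOneSerreDischarged — Serre's fact dR₁ discharged: the `GL₁` reciprocity conjuncts over
# EVERY number field reduce to the labelled Hodge–Tate weights of Weil's characters
# (solo-Langlands-informed s114)

The two named facts of the `GL₁` analysis are now theorems of the tree:

* dR₁ = `HeckeCharacter.exists_lAdic_isDeRhamFramed` (Serre 1968, III §2.3 with App. A.5; Conrad 2011,
  App. B Prop. B.4: the `ℓ`-adic character `r_{θ,ι}` of an algebraic Hecke character is de Rham above `ℓ`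
  for Fontaine's PINNED datum) — `HeckeCharacter.exists_lAdic_isDeRhamFramed_holds`
  (`Literature/NumberTheory/GaloisRepresentations/HeckeCharacterLAdicDeRham`, s114: unit `B_dR⁺`-period
  lifting, Lubin–Tate conjugate periods over the Galois closure, de Rham descent);
* FM₁ = `FramedGaloisRep.exists_heckeCharacter_of_isDeRhamFramed` (rank-one Fontaine–Mazur) —
  `GLOneRigidity.existsHeckeCharacter_of_isDeRhamFramed_holds` (`SoloInformedGLOneUnconditional`, s113).

Feeding both into the accepted `GL₁` dictionary (Λ21–Λ26: `SoloInformedGLOneGaloisToAutomorphic`,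
`SoloInformedGLOneR3plus`, `SoloInformedGLOneHodgeTateParallel`) leaves statements with NO named fact:

* ★★ `isDeRhamFramed_weilRep_toLocal_all`, `isDeRhamFramed_weilRep` — Weil's character of every algebraic
  Hecke character of every number field is de Rham at every `v ∣ ℓ`, for THE pinned datum / every `𝓡`;
* ★★★ `automorphicToGaloisR3plus_one_iff_ht`, `globalLanglandsCorrespondenceGLnR3plus_one_iff_ht`,
  `globalLanglandsCorrespondenceGLnR3plus_one_iff_ht_nonparallel`,
  `globalLanglandsCorrespondenceGLnR3plus_one_iff_automorphicToGaloisR3plus` — **the R3⁺-repaired `GL₁`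
  conjunct over ANY number field `K` is equivalent to its automorphic-to-Galois half, and to HT₁ alone**:
  the labelled Hodge–Tate weights of `r_{θ,ι}|Γ_{K_v}` at each continuous label `τ : K_v → ℚ̄_ℓ` are
  `{n_{ι∘τ}(θ)}` — and only NON-PARALLEL `θ` (CM types; they exist iff `K` contains a CM field) remain;
* ★★★ `galoisToAutomorphic_one_iff_wd`, `globalLanglandsCorrespondenceGLn_one_iff_wd`,
  `globalLanglandsCorrespondenceGLn_one_iff_automorphicToGalois` — the summit's OWN `n = 1` conjunct over
  any `K` is equivalent to its clause (A)₁, and to the Weil–Deligne clause (WD₁) of the pinned datum on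
  Weil's characters (a statement the datum's specification does not decide,
  `PstSpecTwist.no_weilDeligne_class_forced_by_spec`).

Plain theorems; no definitions, no named facts.

Citations: [SerreAbelianLadic1968] Ch. III §1.1, §2.3, App. A.5; [Conrad2011LiftingGlobal] App. B Prop. B.4;
[FontaineAsterisque223III] Exp. III §1.5, §3; [BrinonConrad2009] Prop. 6.3.8; [Patrikis2019] Prop. 2.2.1,
Cor. 2.2.3; [BuzzardGeeLMS2014] Conj. 3.2.1–3.2.2, Rem. 3.2.3, 3.2.5; [FontaineMazurGeometric1995] Conj. 1.
-/

noncomputable section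
open scoped MatrixGroups Matrix Classical NumberField
open NumberField IsDedekindDomain Field Filter
open Literature.NumberTheory.Automorphic Literature.NumberTheory.GaloisRepresentations
open Literature.NumberTheory.PAdicHodge

namespace Summit.Langlands.Langlands.Theorems

namespace GLOneRigidity

section SerreDischarged

variable {K : Type} [Field K] [NumberField K] {hcpt : isCompact_glFiniteIntegralLevel 1 K}
  {ℓ : ℕ} [Fact ℓ.Prime] {θ : HeckeCharacter K} {p q : InfinitePlace K → ℤ}
  {T : Finset (HeightOneSpectrum (𝓞 K))} {e : HeightOneSpectrum (𝓞 K) → ℕ}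

/-! ### §1 dR₁ for Weil's characters, unconditionally -/

/-- ★★ **Weil's character `r_{θ,ι}` of an algebraic Hecke character of ANY number field is de Rham at
every `v ∣ ℓ` for Fontaine's pinned datum `fontainePstAdicCompletion v ℓ hv`** — Serre's theorem, now a
theorem of the tree (`HeckeCharacter.exists_lAdic_isDeRhamFramed_holds`), read on the rigid witness
(`eq_weilRep_of_eventually_hasFrobCharpolyAt`). [cite: SerreAbelianLadic1968, Ch. III §2.3 and App. A.5]
[cite: Conrad2011LiftingGlobal, App. B, Prop. B.4] [cite: FontaineAsterisque223III, Exp. III §1.5 and §3] -/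
theorem isDeRhamFramed_weilRep_toLocal_all (ι : PadicAlgCl ℓ ≃+* ℂ) (hinf : θ.HasInfinityType p q)
    (hmod : HeckeCharacter.IsModulus θ T e) (v : HeightOneSpectrum (𝓞 K))
    (hv : ((ℓ : ℕ) : 𝓞 K) ∈ v.asIdeal) :
    (fontainePstAdicCompletion v ℓ hv).IsDeRhamFramed ((hinf.weilRep hmod ι).toLocal v) := by
  obtain ⟨r, hr, hdR⟩ := HeckeCharacter.exists_lAdic_isDeRhamFramed_holds K ℓ θ
    (θ.isAlgebraic_iff_exists_hasInfinityType.mpr ⟨p, q, hinf⟩) ι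
  obtain rfl : r = hinf.weilRep hmod ι := by
    refine eq_weilRep_of_eventually_hasFrobCharpolyAt ι hinf hmod ?_
    filter_upwards [T.eventually_cofinite_notMem,
      Literature.RingTheory.DedekindDomain.eventually_not_mem_asIdeal (R := 𝓞 K)
        (Nat.cast_ne_zero.mpr (Fact.out : ℓ.Prime).ne_zero)] with w hwT hwℓ
    exact (hr w hwℓ (HeckeCharacter.isUnramifiedAt_of_isModulus' hmod hwT)).2
  exact hdR v hv

/-- ★★ **… hence for the `p`-adic Hodge datum of every reciprocity datum `𝓡`** (`𝓡.pst = fontainePstAdicCompletion`).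
[cite: SerreAbelianLadic1968, Ch. III §2.3 and App. A.5] [cite: Conrad2011LiftingGlobal, App. B, Prop. B.4] -/
theorem isDeRhamFramed_weilRep (𝓡 : ReciprocityData K) (ι : PadicAlgCl ℓ ≃+* ℂ)
    (hinf : θ.HasInfinityType p q) (hmod : HeckeCharacter.IsModulus θ T e)
    (v : HeightOneSpectrum (𝓞 K)) (hv : ((ℓ : ℕ) : 𝓞 K) ∈ v.asIdeal) :
    (𝓡.pst ℓ v hv).IsDeRhamFramed ((hinf.weilRep hmod ι).toLocal v) :=
  isDeRhamFramed_weilRep_of_fact HeckeCharacter.exists_lAdic_isDeRhamFramed_holds 𝓡 ι hinf hmod v hv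

/-! ### §2 The R3⁺-repaired `GL₁` conjunct over every number field is HT₁ -/

/-- ★★★ **Clause (A⁺)₁ over any `K` ⟺ HT₁**: every cuspidal `π` of `GL₁/K` with Hecke character `θ` is
Hodge–Tate compatible with `r_{θ,ι}` at every `v ∣ ℓ` (the de Rham half of Λ23
`automorphicToGaloisR3plus_one_iff_weilRep` is §1). [cite: BuzzardGeeLMS2014, Conj. 3.2.1 and Rem. 3.2.3]
[cite: SerreAbelianLadic1968, Ch. III §1.1, §2.3 and App. A.5] -/
theorem automorphicToGaloisR3plus_one_iff_ht (𝓡 : ReciprocityData K) :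
    R3plus.AutomorphicToGaloisR3plus 1 𝓡 hcpt ↔
      ∀ (π : CuspidalAutomorphicRepData 1 K hcpt) (θ : HeckeCharacter K),
        (∀ (g : (AdelicGroupData.gl 1 K).Adelic), ∀ φ ∈ π.1.W,
          rightTranslation (AdelicGroupData.gl 1 K) g φ -
            ((θ (Matrix.GeneralLinearGroup.det g) : ℂˣ) : ℂ) • φ ∈ π.1.W') →
        ∀ (p q : InfinitePlace K → ℤ) (hinf : θ.HasInfinityType p q)
          (T : Finset (HeightOneSpectrum (𝓞 K))) (e : HeightOneSpectrum (𝓞 K) → ℕ)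
          (hmod : HeckeCharacter.IsModulus θ T e) (ℓ : ℕ) [Fact ℓ.Prime] (ι : PadicAlgCl ℓ ≃+* ℂ)
          (v : HeightOneSpectrum (𝓞 K)) (hv : ((ℓ : ℕ) : 𝓞 K) ∈ v.asIdeal),
          R3plus.HodgeTateCompatibleAt 𝓡 ι π.1 (hinf.weilRep hmod ι) v hv := by
  rw [automorphicToGaloisR3plus_one_iff_weilRep 𝓡]
  exact ⟨fun h π θ hχ p q hinf T e hmod ℓ _ ι v hv => (h π θ hχ p q hinf T e hmod ℓ ι).2 v hv,
    fun h π θ hχ p q hinf T e hmod ℓ _ ι =>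
      ⟨fun v hv => isDeRhamFramed_weilRep 𝓡 ι hinf hmod v hv,
        fun v hv => h π θ hχ p q hinf T e hmod ℓ ι v hv⟩⟩

/-- ★★★ **The R3⁺-repaired `n = 1` conjunct over any `K` ⟺ HT₁** (Λ23
`globalLanglandsCorrespondenceGLnR3plus_one_iff_ht_of_facts` with both facts discharged).
[cite: BuzzardGeeLMS2014, Conj. 3.2.1–3.2.2, Rem. 3.2.3 and Rem. 3.2.5] [cite: Patrikis2019, Prop. 2.2.1]
[cite: SerreAbelianLadic1968, Ch. III §1.1, §2.3 and App. A.5] -/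
theorem globalLanglandsCorrespondenceGLnR3plus_one_iff_ht (𝓡 : ReciprocityData K) :
    R3plus.GlobalLanglandsCorrespondenceGLnR3plus 1 K 𝓡 hcpt ↔
      ∀ (π : CuspidalAutomorphicRepData 1 K hcpt) (θ : HeckeCharacter K),
        (∀ (g : (AdelicGroupData.gl 1 K).Adelic), ∀ φ ∈ π.1.W,
          rightTranslation (AdelicGroupData.gl 1 K) g φ -
            ((θ (Matrix.GeneralLinearGroup.det g) : ℂˣ) : ℂ) • φ ∈ π.1.W') →
        ∀ (p q : InfinitePlace K → ℤ) (hinf : θ.HasInfinityType p q)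
          (T : Finset (HeightOneSpectrum (𝓞 K))) (e : HeightOneSpectrum (𝓞 K) → ℕ)
          (hmod : HeckeCharacter.IsModulus θ T e) (ℓ : ℕ) [Fact ℓ.Prime] (ι : PadicAlgCl ℓ ≃+* ℂ)
          (v : HeightOneSpectrum (𝓞 K)) (hv : ((ℓ : ℕ) : 𝓞 K) ∈ v.asIdeal),
          R3plus.HodgeTateCompatibleAt 𝓡 ι π.1 (hinf.weilRep hmod ι) v hv :=
  globalLanglandsCorrespondenceGLnR3plus_one_iff_ht_of_facts HeckeCharacter.exists_lAdic_isDeRhamFramed_holds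
    existsHeckeCharacter_of_isDeRhamFramed_holds 𝓡

/-- ★★★ **For `n = 1` the R3⁺-repaired reciprocity over any `K` is equivalent to its automorphic-to-Galois
half (A⁺)₁**: (B⁺)₁ follows from FM₁, rigidity and the Hodge–Tate clause of (A⁺)₁.
[cite: BuzzardGeeLMS2014, Conj. 3.2.1–3.2.2] [cite: FontaineMazurGeometric1995, Conj. 1]
[cite: Patrikis2019, Prop. 2.2.1] -/
theorem globalLanglandsCorrespondenceGLnR3plus_one_iff_automorphicToGaloisR3plus (𝓡 : ReciprocityData K) :
    R3plus.GlobalLanglandsCorrespondenceGLnR3plus 1 K 𝓡 hcpt ↔ R3plus.AutomorphicToGaloisR3plus 1 𝓡 hcpt := by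
  rw [globalLanglandsCorrespondenceGLnR3plus_one_iff_ht 𝓡, automorphicToGaloisR3plus_one_iff_ht 𝓡]

/-- ★★★ **… and equivalent to HT₁ for NON-PARALLEL algebraic Hecke characters only** (the parallel case
is Λ24 `hodgeTateCompatibleAt_weilRep_of_embExponent_eq`); non-parallel types exist iff `K` contains a CM
field, so this is vacuous — and the conjunct HOLDS — whenever `K` has a real place
(`globalLanglandsCorrespondenceGLnR3plus_one_of_isReal`). [cite: BuzzardGeeLMS2014, Conj. 3.2.1–3.2.2 and Rem. 3.2.3]
[cite: Weil1956, §1] [cite: SerreAbelianLadic1968, Ch. III §1.1 and App. A.5] -/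
theorem globalLanglandsCorrespondenceGLnR3plus_one_iff_ht_nonparallel (𝓡 : ReciprocityData K) :
    R3plus.GlobalLanglandsCorrespondenceGLnR3plus 1 K 𝓡 hcpt ↔
      ∀ (π : CuspidalAutomorphicRepData 1 K hcpt) (θ : HeckeCharacter K),
        (∀ (g : (AdelicGroupData.gl 1 K).Adelic), ∀ φ ∈ π.1.W,
          rightTranslation (AdelicGroupData.gl 1 K) g φ -
            ((θ (Matrix.GeneralLinearGroup.det g) : ℂˣ) : ℂ) • φ ∈ π.1.W') →
        ∀ (p q : InfinitePlace K → ℤ) (hinf : θ.HasInfinityType p q),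
          (¬ ∃ n₀ : ℤ, ∀ φ : K →+* ℂ, HeckeCharacter.embExponent p q φ = n₀) →
          ∀ (T : Finset (HeightOneSpectrum (𝓞 K))) (e : HeightOneSpectrum (𝓞 K) → ℕ)
            (hmod : HeckeCharacter.IsModulus θ T e) (ℓ : ℕ) [Fact ℓ.Prime] (ι : PadicAlgCl ℓ ≃+* ℂ)
            (v : HeightOneSpectrum (𝓞 K)) (hv : ((ℓ : ℕ) : 𝓞 K) ∈ v.asIdeal),
            R3plus.HodgeTateCompatibleAt 𝓡 ι π.1 (hinf.weilRep hmod ι) v hv :=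
  globalLanglandsCorrespondenceGLnR3plus_one_iff_ht_nonparallel_of_facts
    HeckeCharacter.exists_lAdic_isDeRhamFramed_holds existsHeckeCharacter_of_isDeRhamFramed_holds 𝓡

/-- **HT₁ ⟹ the repaired conjunct**, over any `K`, for every reciprocity datum.
[cite: BuzzardGeeLMS2014, Conj. 3.2.1–3.2.2] [cite: SerreAbelianLadic1968, Ch. III App. A.5] -/
theorem globalLanglandsCorrespondenceGLnR3plus_one_of_ht (𝓡 : ReciprocityData K)
    (hHT : ∀ (π : CuspidalAutomorphicRepData 1 K hcpt) (θ : HeckeCharacter K),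
      (∀ (g : (AdelicGroupData.gl 1 K).Adelic), ∀ φ ∈ π.1.W,
        rightTranslation (AdelicGroupData.gl 1 K) g φ -
          ((θ (Matrix.GeneralLinearGroup.det g) : ℂˣ) : ℂ) • φ ∈ π.1.W') →
      ∀ (p q : InfinitePlace K → ℤ) (hinf : θ.HasInfinityType p q)
        (T : Finset (HeightOneSpectrum (𝓞 K))) (e : HeightOneSpectrum (𝓞 K) → ℕ)
        (hmod : HeckeCharacter.IsModulus θ T e) (ℓ : ℕ) [Fact ℓ.Prime] (ι : PadicAlgCl ℓ ≃+* ℂ)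
        (v : HeightOneSpectrum (𝓞 K)) (hv : ((ℓ : ℕ) : 𝓞 K) ∈ v.asIdeal),
        R3plus.HodgeTateCompatibleAt 𝓡 ι π.1 (hinf.weilRep hmod ι) v hv) :
    R3plus.GlobalLanglandsCorrespondenceGLnR3plus 1 K 𝓡 hcpt :=
  (globalLanglandsCorrespondenceGLnR3plus_one_iff_ht 𝓡).mpr hHT

/-- **(A⁺)₁ ⟹ the repaired conjunct**, over any `K` — no named fact.
[cite: BuzzardGeeLMS2014, Conj. 3.2.1–3.2.2] [cite: FontaineMazurGeometric1995, Conj. 1] -/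
theorem globalLanglandsCorrespondenceGLnR3plus_one_of_automorphicToGaloisR3plus' (𝓡 : ReciprocityData K)
    (hA : R3plus.AutomorphicToGaloisR3plus 1 𝓡 hcpt) :
    R3plus.GlobalLanglandsCorrespondenceGLnR3plus 1 K 𝓡 hcpt :=
  (globalLanglandsCorrespondenceGLnR3plus_one_iff_automorphicToGaloisR3plus 𝓡).mpr hA

/-! ### §3 The summit's own `n = 1` conjunct over every number field -/

/-- ★★★ **Clause (B)₁ of `Langlands` over any `K` ⟺ (WD₁)**: the pinned datum attaches to Weil's character
`r_{θ,ι}|Γ_{K_v}` at every `v ∣ ℓ` a Weil–Deligne representation of `ι`-class `rec₁(θ_v ∘ det)` (Λ22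
`galoisToAutomorphic_one_iff_wd_of_fact`, its de Rham premise discharged by §1).
[cite: BuzzardGeeLMS2014, Conj. 3.2.2 and Rem. 3.2.5] [cite: Patrikis2019, Prop. 2.2.1]
[cite: FontaineAsterisque223VIII, §2.3.7] -/
theorem galoisToAutomorphic_one_iff_wd (𝓡 : ReciprocityData K) :
    GaloisToAutomorphic 1 𝓡 hcpt ↔
      ∀ (θ : HeckeCharacter K) (p q : InfinitePlace K → ℤ) (hinf : θ.HasInfinityType p q)
        (T : Finset (HeightOneSpectrum (𝓞 K))) (e : HeightOneSpectrum (𝓞 K) → ℕ)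
        (hmod : HeckeCharacter.IsModulus θ T e) (ℓ : ℕ) [Fact ℓ.Prime] (ι : PadicAlgCl ℓ ≃+* ℂ)
        (v : HeightOneSpectrum (𝓞 K)) (hv : ((ℓ : ℕ) : 𝓞 K) ∈ v.asIdeal),
        ∃ (r : WeilDeligneRep (v.adicCompletion K) (PadicAlgCl ℓ) (Fin 1 → PadicAlgCl ℓ))
          (rℂ : WeilDeligneRep (v.adicCompletion K) ℂ (Fin 1 → ℂ)),
          (𝓡.pst ℓ v hv).IsWeilDeligneOf ((hinf.weilRep hmod ι).toLocal v) r ∧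
            r.IsTransportAlong (ι : PadicAlgCl ℓ →+* ℂ) rℂ ∧
            rℂ.HasFrobSemisimpleClass
              ((𝓡.llc v).recGL 1 (IrrClass.mk (SmoothIrrep.ofQuasiChar
                (⟨θ.localComponent v, θ.continuous_localComponent v⟩ :
                  QuasiChar (v.adicCompletion K))))) := by
  rw [galoisToAutomorphic_one_iff_wd_of_fact existsHeckeCharacter_of_isDeRhamFramed_holds 𝓡]
  exact ⟨fun h θ p q hinf T e hmod ℓ _ ι v hv =>
      h θ p q hinf T e hmod ℓ ι (fun w hw => isDeRhamFramed_weilRep 𝓡 ι hinf hmod w hw) v hv,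
    fun h θ p q hinf T e hmod ℓ _ ι _ v hv => h θ p q hinf T e hmod ℓ ι v hv⟩

/-- ★★★ **The summit's `n = 1` conjunct over any `K` ⟺ (WD₁)** (Λ22
`globalLanglandsCorrespondenceGLn_one_iff_wd_of_facts`, both facts discharged): a property of the
`Classical.epsilon`-pinned Weil–Deligne values which the datum's specification does not decide.
[cite: BuzzardGeeLMS2014, Conj. 3.2.1–3.2.2 and Rem. 3.2.5] [cite: FontaineMazurGeometric1995, Conj. 1]
[cite: FontaineAsterisque223VIII, §2.3.7] -/
theorem globalLanglandsCorrespondenceGLn_one_iff_wd (𝓡 : ReciprocityData K) :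
    GlobalLanglandsCorrespondenceGLn 1 K 𝓡 hcpt ↔
      ∀ (θ : HeckeCharacter K) (p q : InfinitePlace K → ℤ) (hinf : θ.HasInfinityType p q)
        (T : Finset (HeightOneSpectrum (𝓞 K))) (e : HeightOneSpectrum (𝓞 K) → ℕ)
        (hmod : HeckeCharacter.IsModulus θ T e) (ℓ : ℕ) [Fact ℓ.Prime] (ι : PadicAlgCl ℓ ≃+* ℂ)
        (v : HeightOneSpectrum (𝓞 K)) (hv : ((ℓ : ℕ) : 𝓞 K) ∈ v.asIdeal),
        ∃ (r : WeilDeligneRep (v.adicCompletion K) (PadicAlgCl ℓ) (Fin 1 → PadicAlgCl ℓ))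
          (rℂ : WeilDeligneRep (v.adicCompletion K) ℂ (Fin 1 → ℂ)),
          (𝓡.pst ℓ v hv).IsWeilDeligneOf ((hinf.weilRep hmod ι).toLocal v) r ∧
            r.IsTransportAlong (ι : PadicAlgCl ℓ →+* ℂ) rℂ ∧
            rℂ.HasFrobSemisimpleClass
              ((𝓡.llc v).recGL 1 (IrrClass.mk (SmoothIrrep.ofQuasiChar
                (⟨θ.localComponent v, θ.continuous_localComponent v⟩ :
                  QuasiChar (v.adicCompletion K))))) :=
  globalLanglandsCorrespondenceGLn_one_iff_wd_of_facts HeckeCharacter.exists_lAdic_isDeRhamFramed_holds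
    existsHeckeCharacter_of_isDeRhamFramed_holds 𝓡

/-- ★★★ **The summit's `n = 1` conjunct over any `K` is equivalent to its clause (A)₁** ((B)₁ follows from
FM₁ and rigidity: Λ22 `galoisToAutomorphic_one_of_automorphicToGalois`).
[cite: BuzzardGeeLMS2014, Conj. 3.2.1–3.2.2] [cite: FontaineMazurGeometric1995, Conj. 1]
[cite: Patrikis2019, Prop. 2.2.1] -/
theorem globalLanglandsCorrespondenceGLn_one_iff_automorphicToGalois (𝓡 : ReciprocityData K) :
    GlobalLanglandsCorrespondenceGLn 1 K 𝓡 hcpt ↔ AutomorphicToGalois 1 𝓡 hcpt :=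
  ⟨fun h => h.1, fun hA => ⟨hA,
    galoisToAutomorphic_one_of_automorphicToGalois existsHeckeCharacter_of_isDeRhamFramed_holds 𝓡 hA⟩⟩

end SerreDischarged

end GLOneRigidity

end Summit.Langlands.Langlands.Theorems

end
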